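import Mathlib
import HarnessLib
import Summits.HubbardSuperconductivity.HubbardSuperconductivity.Theorems.KLProgrammeKLRegimeEngineTowerWtPowTwoLegExport
import Summits.HubbardSuperconductivity.HubbardSuperconductivity.Theorems.KLProgrammeKLRegimeEngineTowerPartialIncrWtPowAtKitSubTad

/-!
# Route `KLProgramme` — crux K3 ENGINE (stmt-HubbardSuperconductivity-20437 `KLRegimeEngineV17F2`), stub (b) / E1 interface (E2) in-tower route, located item
# «(E2)-ROUTE-TADPOLE», JOIN step (G4) «partial block»: THE TWO-LEG TADPOLE-FREE BORN ROW OF A PARTIAL BLOCK `𝒱_{J₂} − 𝒱_{dk}` (`dk ≤ J₂`) AT THE k-FREE BOUNDS AND IN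
# CLOSED FORM FROM THE DEGREE-`Dw` LAW's ROWS AT ITS BLOCK — the «F5 pattern on a partial block»
# (twin of …TowerWtPowTwoLegExport §1/§2 with the slice `(Λ_{J₂}, Λ_{dk}]`, per pin, any output family `J′ ≥ dk`; interface memo
#  HOME/hubbard-kl-k3c3-p2/g20/E2-TOWER-SIDE-INTERFACE.md §2(d)/§5 «read-out PARTIAL block»; k3c2-p3 g19 E2-CELL-READER.md §9 (G4); cell gate-hubbard-kl, seat hubbard-kl-k3c3-p2 g21)

WHY.  The (E2) reader's level-`i` assembly `𝒱_i[K_n] = 𝒱_d + Σ_{1≤k′<k} Δ_{k′} + (𝒱_i − 𝒱_{dk})` (`klTowerInput_eq_zero_add_sum`, `dk ≤ i < d(k+1)`) reads, block by block, the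
tadpole-free two-leg born row `klWtPinnedSumPow … (dk′) j Dw 2 (Δ_{k′} − Δ_Γ𝒱_{dk′}) q w ≤ X₂·klLevUnitF β M 0 1 (dk′)` (✓ `klWtPinnedSumPow_two_subTad_le_of_rows`); the LAST
summand is a PARTIAL block.  Its sharp kit per pin is …TowerPartialIncrWtPowAtKitSubTad (input sizes served by the block's measured carrier `klTowerMeasWtPowAt … d k j Dw` — the
partial block has the SAME input `𝒱_{dk}` as the full block).  Here, verbatim as …TowerWtPowTwoLegExport: the partial slice's Gram/decay/overlap constants are taken at the SAME
k-free dominants `κ̄ ᾱ c̄r c̄c` as the law's blocks (`κ²·8^{dk} ≤ κ̄²`, `α ≤ ᾱ·4^{dk}`, overlaps `≤ c̄r, c̄c`), so the kit's six parameters are the law's `W Z σ τ ψ Φ` and the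
right side is LITERALLY the full block's; then `towerStepTwoSub_le_closed` (…TowerChernoffTwoLegSub; pure real analysis, generic in the born quantity) gives the closed form
from the law's exported rows at block `k`:

* §1 **`klWtPinnedSumPow_partialIncr_subTad_div_le_kitStep_of_bounds (j Dw)`** — general output degree `2(q+1)`, per pin, floor units `klLevUnitF β M 0 (q+1) (dk)`;
* §2 **`wtPowTwoLegPartialSub_hstep_of_blockBounds (j Dw)`** — its `q = 0` instance in the literal `hstep₂` shape (names pinned by equations, as `wtPowTwoLegSub_hstep_of_blockBounds`);
* §3 **`klWtPinnedSumPow_two_partialIncr_subTad_le_of_rows`** — from the law's THIRD conjunct at block `k` (profile rows `4 ≤ m ≤ D`), the imports `ι₁ ι₂ ι₃` at block `k`, the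
  step §2 and the law's own numerics `hx₁ hx₂ hx₃ hy hθ`: every pin of `(𝒱_{J₂} − 𝒱_{dk}) − Δ_Γ𝒱_{dk}` at `F_{J′}` is `≤ X₂·klLevUnitF β M 0 1 (dk)`,
  `X₂ = 15σ²(ι₃λ²) + A′(4Q′)x₁³/(1−x₁) + eψG·ΦG/(1−ΦG)` — the full block's closed form (✓ p732893), no tadpole term.
Compositions of landed theorems and real algebra; slice/block constants (`κ`, degree-`Dw` weighted `α`, `cr/cc`) are HYPOTHESES (STOP RULE, pen g27 (R465)(E)(iii)/(R477): no
T3/T4 supplier row; the Gram row is weight-free and dischargeable verbatim by `gram_sliceCT_bgmFat_sharp_klEng`, which is `Λ`-generic); nothing asserts (E2), (X).3, (b), any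
stub, K3, U₀, the window or superconductivity.
References: BGM 2006 §2.7 (2.70)–(2.71a), §2.8 (2.76)–(2.84), (2.93)–(2.98), §3 (3.2)–(3.8) [cite: BenfattoGiulianiMastropietro2006].
-/

noncomputable section

namespace Summit.HubbardSuperconductivity.HubbardSuperconductivity.Theorems.EngineV8

set_option linter.dupNamespace false -- summit = problem name (single-conjunct summit), D-0017

open Classical
open Real Finset Literature.MathematicalPhysics.QuantumLattice Literature.Probability.LatticeModels GrassmannAlgebra
open Literature.MathematicalPhysics.QuantumLattice.FermiRG
open Summit.HubbardSuperconductivity.HubbardSuperconductivity.Theorems.KLProgrammeLegKernels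
open Summit.HubbardSuperconductivity.HubbardSuperconductivity.Theorems.KLRegimeSplit
open Summit.HubbardSuperconductivity.HubbardSuperconductivity.Theorems.DispersionFlow

/-! ## §1–§2 The TADPOLE-FREE degree-`Dw` weighted step of a partial block (`k ≥ 1`) at k-free bounds, per pin -/

section Link

variable {L M : ℕ} [NeZero L] [NeZero M]

/-- §1 **THE TADPOLE-FREE DEGREE-`Dw` WEIGHTED STEP OF A PARTIAL BLOCK AT k-FREE BOUNDS OF THE SLICE DATA, per pin** (twin of
`klTowerBornWtPowSubTadAt_succ_le_kitStep_of_bounds` …TowerWtPowTwoLegExport §1 and of WB1 §4 `klWtPinnedSumAt_partialIncr_le_kitStep_of_bounds`): `1 ≤ d`, `1 ≤ k`,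
`dk ≤ J′`, `dk ≤ J₂`, token `Z^K_{Λ_{dk}} ≠ 0`; the PARTIAL slice's Gram `κ` with `κ²·8^{dk} ≤ κ̄²`, degree-`Dw` weighted decay `α ≤ ᾱ·4^{dk}` and overlaps `≤ c̄r, c̄c` at `F_{J′}`;
`card/2 ≤ D`; truncation `N ≥ 1`; kit guard.  Conclusion, in track-`0` floor units at the input boundary, with the k-free names of W2/W5
(`W̄ = 32c̄r/c̄c`, `Z̄ = ε²c̄c²/8`, `σ̄ = κ̄²/c̄c²`, `τ̄ = 4e⁴κ̄²/c̄c²`, `ψ̄ = c̄c²/κ̄²`, `Φ̄ = e·ᾱ·c̄c/(κ̄²·c̄r)`, `μ̄ m = W̄·Z̄^m·klTowerMeasWtPowAt … d k j Dw (2m)/klLevUnitF β M 0 m (dk−1)`):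
`klWtPinnedSumPow … J′ j Dw (2(q+1)) ((𝒱_{J₂} − 𝒱_{dk}) − Δ_Γ𝒱_{dk}) i w″ / klLevUnitF β M 0 (q+1) (dk) ≤ towerFO D σ̄ μ̄♭ (q+1) + Σ_{n∈Icc 2 N} e·Φ̄^{n−1}·ψ̄^{q+1}·towerS D τ̄ μ̄ n (q+1) +
ψ̄^{q+1}·e·V̄·(Φ̄V̄)^N/(1−Φ̄V̄)` — the SAME right side as the full block's. [cite: BenfattoGiulianiMastropietro2006, (2.70)-(2.71a), §2.8 (2.76)-(2.84), (2.93), §3 (3.2)-(3.8)] -/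
theorem klWtPinnedSumPow_partialIncr_subTad_div_le_kitStep_of_bounds {β : ℝ} (hβ : 0 < β) (U μ : ℝ) (K : TrigPolyC4v) (j Dw : ℕ) {d k J' J₂ : ℕ}
    (hd : 1 ≤ d) (hk : 1 ≤ k) (hJ' : d * k ≤ J') (hJ₂ : d * k ≤ J₂)
    (hZ : hubbardEffPartitionFnCT L M β U μ 0 K (klScale klE0 (d * k)) ≠ 0)
    {κ κb : ℝ} (hκ : 0 < κ) (hκb : 0 < κb) (hκκb : κ ^ 2 * (8 : ℝ) ^ (d * k) ≤ κb ^ 2)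
    (hGB : IsGramBoundedR ((sectorSubMatrix L M β (bgmFatMultiplier L M klE0 β (nambuXiCT L μ K) (d * k - 1))).transpose *
      hubbardCovSliceCT L M β μ 0 K (klScale klE0 J₂) (klScale klE0 (d * k)) *
        sectorSubMatrix L M β (bgmFatMultiplier L M klE0 β (nambuXiCT L μ K) (d * k - 1))) κ)
    {α αb : ℝ} (hαb : 0 < αb) (hααb : α ≤ αb * (4 : ℝ) ^ (d * k))
    (hrow : ∀ X, ∑ Y, ‖((sectorSubMatrix L M β (bgmFatMultiplier L M klE0 β (nambuXiCT L μ K) (d * k - 1))).transpose *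
        hubbardCovSliceCT L M β μ 0 K (klScale klE0 J₂) (klScale klE0 (d * k)) *
          sectorSubMatrix L M β (bgmFatMultiplier L M klE0 β (nambuXiCT L μ K) (d * k - 1))) X Y‖ *
        klScaleWtPow L M β j Dw {latticeLegPos (2 * (2 * M)) X, latticeLegPos (2 * (2 * M)) Y} ≤ α)
    (hcol : ∀ Y, ∑ X, ‖((sectorSubMatrix L M β (bgmFatMultiplier L M klE0 β (nambuXiCT L μ K) (d * k - 1))).transpose *
        hubbardCovSliceCT L M β μ 0 K (klScale klE0 J₂) (klScale klE0 (d * k)) *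
          sectorSubMatrix L M β (bgmFatMultiplier L M klE0 β (nambuXiCT L μ K) (d * k - 1))) X Y‖ *
        klScaleWtPow L M β j Dw {latticeLegPos (2 * (2 * M)) X, latticeLegPos (2 * (2 * M)) Y} ≤ α)
    {crb ccb : ℝ} (hcrb : 0 < crb) (hccb : 0 < ccb)
    (hrow' : ∀ X'', ∑ X', ‖(sectorAnalysisMatrix L M β (klAnisoFamily L M β μ K klE0 J') *
        sectorSubMatrix L M β (bgmFatMultiplier L M klE0 β (nambuXiCT L μ K) (d * k - 1))) X'' X'‖ *
        klScaleWtPow L M β j Dw {latticeLegPos (2 * (2 * M)) X'', latticeLegPos (2 * (2 * M)) X'} ≤ crb)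
    (hcol' : ∀ X', ∑ X'', ‖(sectorAnalysisMatrix L M β (klAnisoFamily L M β μ K klE0 J') *
        sectorSubMatrix L M β (bgmFatMultiplier L M klE0 β (nambuXiCT L μ K) (d * k - 1))) X'' X'‖ *
        klScaleWtPow L M β j Dw {latticeLegPos (2 * (2 * M)) X'', latticeLegPos (2 * (2 * M)) X'} ≤ ccb)
    {D : ℕ} (hD : Fintype.card (SpaceTimeIdx L M × SectorLeg (sectorCount (d * k - 1))) / 2 ≤ D)
    {N : ℕ} (hN : 1 ≤ N)
    (hguard : exp 1 * αb * ccb / (κb ^ 2 * crb) *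
      towerV D (4 * exp 4 * κb ^ 2 / ccb ^ 2)
        (fun m => 32 * crb / ccb * (imagTimeWeight β M ^ 2 * ccb ^ 2 / 8) ^ m *
          (klTowerMeasWtPowAt L M β U μ K d k j Dw (2 * m) / klLevUnitF β M 0 m (d * k - 1))) < 1)
    (q : ℕ) (i : Fin (2 * (q + 1))) (w'' : SpaceTimeIdx L M × SectorLeg (sectorCount J')) :
    klWtPinnedSumPow L M β μ K J' j Dw (2 * (q + 1))
        ((klEffectiveAction L M β U μ K klE0 J₂ - klTowerInput L M β U μ K d k) -
          grassmannLaplacian ℂ (hubbardCovSliceCT L M β μ 0 K (klScale klE0 J₂) (klScale klE0 (d * k))) (klTowerInput L M β U μ K d k)) i w'' / klLevUnitF β M 0 (q + 1) (d * k) ≤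
      towerFO D (κb ^ 2 / ccb ^ 2)
          (fun m => if q + 2 < m then 32 * crb / ccb * (imagTimeWeight β M ^ 2 * ccb ^ 2 / 8) ^ m *
            (klTowerMeasWtPowAt L M β U μ K d k j Dw (2 * m) / klLevUnitF β M 0 m (d * k - 1)) else 0) (q + 1) +
        ∑ n ∈ Icc 2 N, exp 1 * (exp 1 * αb * ccb / (κb ^ 2 * crb)) ^ (n - 1) * (ccb ^ 2 / κb ^ 2) ^ (q + 1) *
          towerS D (4 * exp 4 * κb ^ 2 / ccb ^ 2)
            (fun m => 32 * crb / ccb * (imagTimeWeight β M ^ 2 * ccb ^ 2 / 8) ^ m *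
              (klTowerMeasWtPowAt L M β U μ K d k j Dw (2 * m) / klLevUnitF β M 0 m (d * k - 1))) n (q + 1) +
        (ccb ^ 2 / κb ^ 2) ^ (q + 1) * exp 1 *
          towerV D (4 * exp 4 * κb ^ 2 / ccb ^ 2)
            (fun m => 32 * crb / ccb * (imagTimeWeight β M ^ 2 * ccb ^ 2 / 8) ^ m *
              (klTowerMeasWtPowAt L M β U μ K d k j Dw (2 * m) / klLevUnitF β M 0 m (d * k - 1))) *
          (exp 1 * αb * ccb / (κb ^ 2 * crb) *
            towerV D (4 * exp 4 * κb ^ 2 / ccb ^ 2)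
              (fun m => 32 * crb / ccb * (imagTimeWeight β M ^ 2 * ccb ^ 2 / 8) ^ m *
                (klTowerMeasWtPowAt L M β U μ K d k j Dw (2 * m) / klLevUnitF β M 0 m (d * k - 1)))) ^ N /
          (1 - exp 1 * αb * ccb / (κb ^ 2 * crb) *
            towerV D (4 * exp 4 * κb ^ 2 / ccb ^ 2)
              (fun m => 32 * crb / ccb * (imagTimeWeight β M ^ 2 * ccb ^ 2 / 8) ^ m *
                (klTowerMeasWtPowAt L M β U μ K d k j Dw (2 * m) / klLevUnitF β M 0 m (d * k - 1)))) := by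
  have hx : 0 < imagTimeWeight β M := imagTimeWeight_pos_of_pos (M := M) hβ
  have hJ₁ : 1 ≤ d * k := le_trans hk (Nat.le_mul_of_pos_left k (by omega))
  have h8 : (0 : ℝ) < (8 : ℝ) ^ (d * k) := by positivity
  have he1 : 0 < exp 1 := exp_pos 1
  have he4' : exp 4 = exp 2 ^ 2 := by rw [← Real.exp_nat_mul]; norm_num
  -- the Gram constant at the bound: `κ′ ≥ κ`, `κ′²·8^{dk} = κ̄²`
  obtain ⟨κ', hκ'0, hκκ', hκ'sq⟩ := exists_sqrt_scaled hκ hκb h8 hκκb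
  have hGB' := TorusFourierL2.isGramBoundedR_of_le hGB hκ.le hκκ'
  -- the decay constant at the bound
  have hα'0 : 0 < αb * (4 : ℝ) ^ (d * k) := by positivity
  have hrow2 : ∀ X, ∑ Y, ‖((sectorSubMatrix L M β (bgmFatMultiplier L M klE0 β (nambuXiCT L μ K) (d * k - 1))).transpose *
      hubbardCovSliceCT L M β μ 0 K (klScale klE0 J₂) (klScale klE0 (d * k)) *
        sectorSubMatrix L M β (bgmFatMultiplier L M klE0 β (nambuXiCT L μ K) (d * k - 1))) X Y‖ *
        klScaleWtPow L M β j Dw {latticeLegPos (2 * (2 * M)) X, latticeLegPos (2 * (2 * M)) Y} ≤ αb * (4 : ℝ) ^ (d * k) :=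
    fun X => (hrow X).trans hααb
  have hcol2 : ∀ Y, ∑ X, ‖((sectorSubMatrix L M β (bgmFatMultiplier L M klE0 β (nambuXiCT L μ K) (d * k - 1))).transpose *
      hubbardCovSliceCT L M β μ 0 K (klScale klE0 J₂) (klScale klE0 (d * k)) *
        sectorSubMatrix L M β (bgmFatMultiplier L M klE0 β (nambuXiCT L μ K) (d * k - 1))) X Y‖ *
        klScaleWtPow L M β j Dw {latticeLegPos (2 * (2 * M)) X, latticeLegPos (2 * (2 * M)) Y} ≤ αb * (4 : ℝ) ^ (d * k) :=
    fun Y => (hcol Y).trans hααb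
  -- abbreviations: the input boundary's units, the unit-free measured array, the parameters
  set ε : ℝ := imagTimeWeight β M with hε
  set Kc : ℝ := ε * ((((2 : ℝ) ^ (5 * (d * k - 1))))⁻¹ * (ε ^ 2)⁻¹) with hKc
  set u : ℝ := (8 : ℝ) ^ (d * k - 1) * ε ^ 2 with hu
  set μ₁ : ℕ → ℝ := fun m => klTowerMeasWtPowAt L M β U μ K d k j Dw (2 * m) / klLevUnitF β M 0 m (d * k - 1) with hμ₁
  set W : ℝ := 32 * crb / ccb with hW
  set Z : ℝ := ε ^ 2 * ccb ^ 2 / 8 with hZ'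
  set σb : ℝ := κb ^ 2 / ccb ^ 2 with hσb
  set τb : ℝ := 4 * exp 4 * κb ^ 2 / ccb ^ 2 with hτb
  set ψb : ℝ := ccb ^ 2 / κb ^ 2 with hψb
  set Φb : ℝ := exp 1 * αb * ccb / (κb ^ 2 * crb) with hΦb
  have hKc0 : 0 < Kc := by positivity
  have hu0 : 0 < u := by positivity
  have hW0 : 0 < W := by positivity
  have hZ0 : 0 < Z := by positivity
  -- `8^{dk} = 8^{dk−1}·8`, `4^{dk} = 4^{dk−1}·4`, `2^{5(dk−1)} = 4^{dk−1}·8^{dk−1}`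
  have h8succ : (8 : ℝ) ^ (d * k) = (8 : ℝ) ^ (d * k - 1) * 8 := by rw [← pow_succ, Nat.sub_add_cancel hJ₁]
  have h4succ : (4 : ℝ) ^ (d * k) = (4 : ℝ) ^ (d * k - 1) * 4 := by rw [← pow_succ, Nat.sub_add_cancel hJ₁]
  have h32 : (2 : ℝ) ^ (5 * (d * k - 1)) = (4 : ℝ) ^ (d * k - 1) * (8 : ℝ) ^ (d * k - 1) := by
    rw [← mul_pow, show (4 : ℝ) * 8 = 2 ^ 5 by norm_num, ← pow_mul]
  have h8p : (0 : ℝ) < (8 : ℝ) ^ (d * k - 1) := by positivity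
  have h4p : (0 : ℝ) < (4 : ℝ) ^ (d * k - 1) := by positivity
  -- the carrier quotient in product units is `μ₁` (plain and truncated); the absolute input sizes are `(ε·K_c)·(u^m·μ₁ m)`
  have hμeq : (fun m : ℕ => klTowerMeasWtPowAt L M β U μ K d k j Dw (2 * m) / (Kc * u ^ m)) = μ₁ := by
    rw [hμ₁, hKc, hu, hε]; exact towerMeasWtPowAt_div_units_eq hβ U μ K d k j Dw
  have hμeq' : (fun m : ℕ => if q + 2 < m then klTowerMeasWtPowAt L M β U μ K d k j Dw (2 * m) / (Kc * u ^ m) else 0) =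
      fun m : ℕ => if q + 2 < m then μ₁ m else 0 := by
    funext m
    split_ifs
    · exact congrFun hμeq m
    · rfl
  have habs : (fun m : ℕ => imagTimeWeight β M * klTowerMeasWtPowAt L M β U μ K d k j Dw (2 * m)) =
      fun m : ℕ => (ε * Kc) * (u ^ m * μ₁ m) := by
    rw [← hμeq]; exact towerInputSizes_units (ε := ε) hu0.ne' hKc0.ne' (fun m => klTowerMeasWtPowAt L M β U μ K d k j Dw m)
  -- the scaled arrays in product form
  have hμbar : (fun m : ℕ => 32 * crb / ccb * (imagTimeWeight β M ^ 2 * ccb ^ 2 / 8) ^ m *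
      (klTowerMeasWtPowAt L M β U μ K d k j Dw (2 * m) / klLevUnitF β M 0 m (d * k - 1))) = fun m : ℕ => W * (Z ^ m * μ₁ m) := by
    funext m; simp only [hW, hZ', hμ₁, hε]; ring
  have hμbar' : (fun m : ℕ => if q + 2 < m then 32 * crb / ccb * (imagTimeWeight β M ^ 2 * ccb ^ 2 / 8) ^ m *
      (klTowerMeasWtPowAt L M β U μ K d k j Dw (2 * m) / klLevUnitF β M 0 m (d * k - 1)) else 0) =
      fun m : ℕ => W * (Z ^ m * (if q + 2 < m then μ₁ m else 0)) := by
    funext m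
    split_ifs
    · simp only [hW, hZ', hμ₁, hε]; ring
    · simp
  -- the four parameter identities and the output constant
  have hσeq : σb * Z = κ' ^ 2 * u := by
    simp only [hσb, hZ', hu]; rw [← hκ'sq, h8succ]; field_simp
  have hτeq : τb * Z = (exp 2 * (κ' + κ')) ^ 2 * u := by
    simp only [hτb, hZ', hu]; rw [← hκ'sq, h8succ, he4']; field_simp; ring
  have hψeq : ψb / Z = κ'⁻¹ ^ 2 / u := by
    simp only [hψb, hZ', hu]; rw [← hκ'sq, h8succ, inv_pow]; field_simp
  have hΦeq : Φb * W = exp 1 * (αb * (4 : ℝ) ^ (d * k)) / κ' ^ 2 * (ε * Kc) := by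
    simp only [hΦb, hW, hKc]
    rw [← hκ'sq, h8succ, h4succ, h32]
    field_simp
    ring
  -- the guard of the kit form, from the final guard
  have hguardkit : exp 1 * (αb * (4 : ℝ) ^ (d * k)) / κ' ^ 2 *
      towerV D ((exp 2 * (κ' + κ')) ^ 2) (fun m' => imagTimeWeight β M * klTowerMeasWtPowAt L M β U μ K d k j Dw (2 * m')) < 1 := by
    have key : exp 1 * (αb * (4 : ℝ) ^ (d * k)) / κ' ^ 2 *
        towerV D ((exp 2 * (κ' + κ')) ^ 2) (fun m' => imagTimeWeight β M * klTowerMeasWtPowAt L M β U μ K d k j Dw (2 * m')) =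
        Φb * towerV D τb (fun m => 32 * crb / ccb * (imagTimeWeight β M ^ 2 * ccb ^ 2 / 8) ^ m *
          (klTowerMeasWtPowAt L M β U μ K d k j Dw (2 * m) / klLevUnitF β M 0 m (d * k - 1))) := by
      rw [habs, hμbar, towerV_units, towerV_units, hτeq]
      calc exp 1 * (αb * (4 : ℝ) ^ (d * k)) / κ' ^ 2 * ((ε * Kc) * towerV D ((exp 2 * (κ' + κ')) ^ 2 * u) μ₁)
          = (exp 1 * (αb * (4 : ℝ) ^ (d * k)) / κ' ^ 2 * (ε * Kc)) * towerV D ((exp 2 * (κ' + κ')) ^ 2 * u) μ₁ := by ring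
        _ = (Φb * W) * towerV D ((exp 2 * (κ' + κ')) ^ 2 * u) μ₁ := by rw [hΦeq]
        _ = Φb * (W * towerV D ((exp 2 * (κ' + κ')) ^ 2 * u) μ₁) := by ring
    rw [key]; exact hguard
  -- (1) the sharp kit form at the input boundary's units, truncation `N + 1`, radius `ρ := κ′`
  have hN₁ : 2 ≤ N + 1 := by omega
  have h1 := klWtPinnedSumPow_partialIncr_subTadpole_le_kit_units (L := L) (M := M) hβ U μ K j Dw hd hk hJ' hJ₂ hZ hκ'0 hGB' hα'0 hrow2 hcol2 hκ'0 hD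
    hguardkit hcrb.le hccb.le hrow' hcol' hN₁ q hu0 hKc0 i w''
  rw [hμeq', hμeq, Nat.add_sub_cancel] at h1
  -- (2) the final kit bracket in the input units (first order on the truncated array)
  have hkit := kitStep_abs_eq_units_mul_trunc (K := W) (u := Z) hW0.ne' hZ0.ne' D σb τb Φb ψb μ₁ (fun m => if q + 2 < m then μ₁ m else 0) N (q + 1)
  rw [hσeq, hτeq, hΦeq, hψeq] at hkit
  -- (3) divide by the output unit
  have hunit : klLevUnitF β M 0 (q + 1) (d * k) = (Kc * u ^ (q + 1)) * ((8 : ℝ) ^ (q + 1) / 32) := by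
    rw [hKc, hu, hε]; exact klLevUnitF_zero_track_succ_units (M := M) hβ hJ₁ (by omega)
  have hU0 : 0 < klLevUnitF β M 0 (q + 1) (d * k) := klLevUnitF_pos hβ 0 _ _
  have hout : (imagTimeWeight β M * crb) * (imagTimeWeight β M * ccb) ^ (2 * q + 1) * (u ^ (q + 1) * Kc) =
      (Z ^ (q + 1) * W) * ((Kc * u ^ (q + 1)) * ((8 : ℝ) ^ (q + 1) / 32)) := by
    simp only [hZ', hW, hε, div_pow, mul_pow, ← pow_mul]
    field_simp
    ring
  rw [hμbar, hμbar', hkit, div_le_iff₀ hU0, hunit]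
  refine h1.trans (le_of_eq ?_)
  rw [hout]
  ring

/-- §2 **THE TADPOLE-FREE TWO-LEG STEP OF A PARTIAL BLOCK IN THE LITERAL `hstep₂` SHAPE** (`q = 0` instance of §1; the six names `W Z σ τ ψ Φ` pinned by equations —
instantiate with `rfl` — exactly as `wtPowTwoLegSub_hstep_of_blockBounds`; single block `k ≥ 1`, per pin, any output family `J′ ≥ dk`).
[cite: BenfattoGiulianiMastropietro2006, (2.70)-(2.71a), §2.8 (2.76)-(2.84), (2.93), §3 (3.2)-(3.8)] -/
theorem wtPowTwoLegPartialSub_hstep_of_blockBounds {β : ℝ} (hβ : 0 < β) (U μ : ℝ) (K : TrigPolyC4v) (j Dw : ℕ) {d k J' J₂ : ℕ}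
    (hd : 1 ≤ d) (hk : 1 ≤ k) (hJ' : d * k ≤ J') (hJ₂ : d * k ≤ J₂)
    (hZ : hubbardEffPartitionFnCT L M β U μ 0 K (klScale klE0 (d * k)) ≠ 0)
    {κ κb : ℝ} (hκ : 0 < κ) (hκb : 0 < κb) (hκκb : κ ^ 2 * (8 : ℝ) ^ (d * k) ≤ κb ^ 2)
    (hGB : IsGramBoundedR ((sectorSubMatrix L M β (bgmFatMultiplier L M klE0 β (nambuXiCT L μ K) (d * k - 1))).transpose *
      hubbardCovSliceCT L M β μ 0 K (klScale klE0 J₂) (klScale klE0 (d * k)) *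
        sectorSubMatrix L M β (bgmFatMultiplier L M klE0 β (nambuXiCT L μ K) (d * k - 1))) κ)
    {α αb : ℝ} (hαb : 0 < αb) (hααb : α ≤ αb * (4 : ℝ) ^ (d * k))
    (hrow : ∀ X, ∑ Y, ‖((sectorSubMatrix L M β (bgmFatMultiplier L M klE0 β (nambuXiCT L μ K) (d * k - 1))).transpose *
        hubbardCovSliceCT L M β μ 0 K (klScale klE0 J₂) (klScale klE0 (d * k)) *
          sectorSubMatrix L M β (bgmFatMultiplier L M klE0 β (nambuXiCT L μ K) (d * k - 1))) X Y‖ *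
        klScaleWtPow L M β j Dw {latticeLegPos (2 * (2 * M)) X, latticeLegPos (2 * (2 * M)) Y} ≤ α)
    (hcol : ∀ Y, ∑ X, ‖((sectorSubMatrix L M β (bgmFatMultiplier L M klE0 β (nambuXiCT L μ K) (d * k - 1))).transpose *
        hubbardCovSliceCT L M β μ 0 K (klScale klE0 J₂) (klScale klE0 (d * k)) *
          sectorSubMatrix L M β (bgmFatMultiplier L M klE0 β (nambuXiCT L μ K) (d * k - 1))) X Y‖ *
        klScaleWtPow L M β j Dw {latticeLegPos (2 * (2 * M)) X, latticeLegPos (2 * (2 * M)) Y} ≤ α)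
    {crb ccb : ℝ} (hcrb : 0 < crb) (hccb : 0 < ccb)
    (hrow' : ∀ X'', ∑ X', ‖(sectorAnalysisMatrix L M β (klAnisoFamily L M β μ K klE0 J') *
        sectorSubMatrix L M β (bgmFatMultiplier L M klE0 β (nambuXiCT L μ K) (d * k - 1))) X'' X'‖ *
        klScaleWtPow L M β j Dw {latticeLegPos (2 * (2 * M)) X'', latticeLegPos (2 * (2 * M)) X'} ≤ crb)
    (hcol' : ∀ X', ∑ X'', ‖(sectorAnalysisMatrix L M β (klAnisoFamily L M β μ K klE0 J') *
        sectorSubMatrix L M β (bgmFatMultiplier L M klE0 β (nambuXiCT L μ K) (d * k - 1))) X'' X'‖ *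
        klScaleWtPow L M β j Dw {latticeLegPos (2 * (2 * M)) X'', latticeLegPos (2 * (2 * M)) X'} ≤ ccb)
    {D : ℕ} (hD : Fintype.card (SpaceTimeIdx L M × SectorLeg (sectorCount (d * k - 1))) / 2 ≤ D)
    (W Z σ τ ψ Φ : ℝ) (hW : W = 32 * crb / ccb) (hZ' : Z = imagTimeWeight β M ^ 2 * ccb ^ 2 / 8)
    (hσ : σ = κb ^ 2 / ccb ^ 2) (hτ : τ = 4 * exp 4 * κb ^ 2 / ccb ^ 2) (hψ : ψ = ccb ^ 2 / κb ^ 2)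
    (hΦ : Φ = exp 1 * αb * ccb / (κb ^ 2 * crb))
    (i : Fin 2) (w'' : SpaceTimeIdx L M × SectorLeg (sectorCount J')) :
    ∀ N : ℕ, 2 ≤ N →
      Φ * towerV D τ (fun m => W * Z ^ m * (klTowerMeasWtPowAt L M β U μ K d k j Dw (2 * m) / klLevUnitF β M 0 m (d * k - 1))) < 1 →
      klWtPinnedSumPow L M β μ K J' j Dw 2
          ((klEffectiveAction L M β U μ K klE0 J₂ - klTowerInput L M β U μ K d k) -
            grassmannLaplacian ℂ (hubbardCovSliceCT L M β μ 0 K (klScale klE0 J₂) (klScale klE0 (d * k))) (klTowerInput L M β U μ K d k)) i w'' /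
          klLevUnitF β M 0 1 (d * k) ≤
        towerFO D σ (fun m => if 2 < m then W * Z ^ m * (klTowerMeasWtPowAt L M β U μ K d k j Dw (2 * m) / klLevUnitF β M 0 m (d * k - 1)) else 0) 1 +
          ∑ n ∈ Icc 2 N, exp 1 * Φ ^ (n - 1) * ψ ^ 1 *
            towerS D τ (fun m => W * Z ^ m * (klTowerMeasWtPowAt L M β U μ K d k j Dw (2 * m) / klLevUnitF β M 0 m (d * k - 1))) n 1 +
          ψ ^ 1 * exp 1 * towerV D τ (fun m => W * Z ^ m * (klTowerMeasWtPowAt L M β U μ K d k j Dw (2 * m) / klLevUnitF β M 0 m (d * k - 1))) *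
            (Φ * towerV D τ (fun m => W * Z ^ m * (klTowerMeasWtPowAt L M β U μ K d k j Dw (2 * m) / klLevUnitF β M 0 m (d * k - 1)))) ^ N /
            (1 - Φ * towerV D τ (fun m => W * Z ^ m * (klTowerMeasWtPowAt L M β U μ K d k j Dw (2 * m) / klLevUnitF β M 0 m (d * k - 1)))) := by
  intro N hN hguard
  subst hW hZ' hσ hτ hψ hΦ
  have h := klWtPinnedSumPow_partialIncr_subTad_div_le_kitStep_of_bounds hβ U μ K j Dw hd hk hJ' hJ₂ hZ hκ hκb hκκb hGB hαb hααb hrow hcol hcrb hccb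
    hrow' hcol' hD (N := N) (by omega) hguard 0 i w''
  simpa only [Nat.zero_add, mul_one, pow_one] using h

end Link

/-! ## §3 The two-leg TADPOLE-FREE born row of a partial block from the law's exported rows at its block (four-piece profile, closed form) -/

section Export

variable {L M : ℕ} [NeZero L] [NeZero M]

/-- §3 **THE TWO-LEG TADPOLE-FREE BORN ROW OF A PARTIAL BLOCK `𝒱_{J₂} − 𝒱_{dk}`, FROM THE LAW's ROWS AT BLOCK `k`, per pin** (twin of
`klWtPinnedSumPow_two_subTad_le_of_rows`, ✓ …TowerWtPowTwoLegExport §2, on the partial block).  Given, at the block `k ≥ 1` of the partial increment: the measured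
profile rows `W·Z^m·klTowerMeasWtPowAt … d k j Dw (2m)/klLevUnitF β M 0 m (dk−1) ≤ A′λ^{m−1}Q′^m` (`4 ≤ m ≤ D`; the THIRD conjunct of
`klTowerBornWtPowAt_le_law_of_inputs_base_tokX` at block `k`), the imports `ι₁ ι₂ ι₃` (degrees `2, 4, 6`) at block `k`, the tadpole-free two-leg step of THIS pin in the kit's
literal form (§2 serves it from the partial slice's data) and the kit's numerics `x₁ < 1`, `2λτQ′ ≤ 1`, `x₃ < 1`, `y < 1`, `θ̄ < 1` (the law's own `hx₁ hx₂ hx₃ hy hθ`):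
`klWtPinnedSumPow … J′ j Dw 2 ((𝒱_{J₂} − 𝒱_{dk}) − Δ_Γ𝒱_{dk}) i w″ ≤ X₂ · klLevUnitF β M 0 1 (dk)` (`= X₂·ε·4^{−dk}`, `klLevUnitF_zero_one`) with the SAME closed form as the
full block, `X₂ = 15σ²(ι₃λ²) + A′(4Q′)·x₁³/(1−x₁) + e·ψ·G·(ΦG/(1−ΦG))`, `G = τ(ι₁λ + ι₂/(2Q′) + ι₃/(4Q′²) + A′Q′/4)` — second order in the imports, no tadpole term
(`towerStepTwoSub_le_closed`, generic in the born quantity). [cite: BenfattoGiulianiMastropietro2006, (2.70)-(2.71a), §2.8 (2.76)-(2.77), (2.83), (2.93)-(2.98)] -/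
theorem klWtPinnedSumPow_two_partialIncr_subTad_le_of_rows {β : ℝ} (hβ : 0 < β) (U μ : ℝ) (K : TrigPolyC4v)
    (j d k D Dw : ℕ) {J' J₂ : ℕ} {lam W Z A' Q' σ Φ ψ τ ι₁ ι₂ ι₃ : ℝ}
    (hlam : 0 < lam) (hA'0 : 0 ≤ A') (hQ'0 : 0 < Q') (hσ : 0 ≤ σ) (hΦ : 0 ≤ Φ) (hψ : 0 ≤ ψ) (hτ : 0 < τ)
    (hμ0 : ∀ m, 0 ≤ W * Z ^ m * (klTowerMeasWtPowAt L M β U μ K d k j Dw (2 * m) / klLevUnitF β M 0 m (d * k - 1)))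
    -- the law's exported rows AT BLOCK k: measured profile, imports
    (hprof : ∀ m, 4 ≤ m → m ≤ D →
      W * Z ^ m * (klTowerMeasWtPowAt L M β U μ K d k j Dw (2 * m) / klLevUnitF β M 0 m (d * k - 1)) ≤ A' * lam ^ (m - 1) * Q' ^ m)
    (hι₁ : W * Z ^ 1 * (klTowerMeasWtPowAt L M β U μ K d k j Dw (2 * 1) / klLevUnitF β M 0 1 (d * k - 1)) ≤ ι₁ * lam)
    (hι₂ : W * Z ^ 2 * (klTowerMeasWtPowAt L M β U μ K d k j Dw (2 * 2) / klLevUnitF β M 0 2 (d * k - 1)) ≤ ι₂ * lam)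
    (hι₃ : W * Z ^ 3 * (klTowerMeasWtPowAt L M β U μ K d k j Dw (2 * 3) / klLevUnitF β M 0 3 (d * k - 1)) ≤ ι₃ * lam ^ 2)
    -- the tadpole-free two-leg step of this pin of the partial block (served by §2)
    (i : Fin 2) (w'' : SpaceTimeIdx L M × SectorLeg (sectorCount J'))
    (hstep₂ : ∀ N : ℕ, 2 ≤ N →
      Φ * towerV D τ (fun m => W * Z ^ m * (klTowerMeasWtPowAt L M β U μ K d k j Dw (2 * m) / klLevUnitF β M 0 m (d * k - 1))) < 1 →
      klWtPinnedSumPow L M β μ K J' j Dw 2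
          ((klEffectiveAction L M β U μ K klE0 J₂ - klTowerInput L M β U μ K d k) -
            grassmannLaplacian ℂ (hubbardCovSliceCT L M β μ 0 K (klScale klE0 J₂) (klScale klE0 (d * k))) (klTowerInput L M β U μ K d k)) i w'' /
          klLevUnitF β M 0 1 (d * k) ≤
        towerFO D σ (fun m => if 2 < m then W * Z ^ m * (klTowerMeasWtPowAt L M β U μ K d k j Dw (2 * m) / klLevUnitF β M 0 m (d * k - 1)) else 0) 1 +
          ∑ n ∈ Icc 2 N, exp 1 * Φ ^ (n - 1) * ψ ^ 1 *
            towerS D τ (fun m => W * Z ^ m * (klTowerMeasWtPowAt L M β U μ K d k j Dw (2 * m) / klLevUnitF β M 0 m (d * k - 1))) n 1 +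
          ψ ^ 1 * exp 1 * towerV D τ (fun m => W * Z ^ m * (klTowerMeasWtPowAt L M β U μ K d k j Dw (2 * m) / klLevUnitF β M 0 m (d * k - 1))) *
            (Φ * towerV D τ (fun m => W * Z ^ m * (klTowerMeasWtPowAt L M β U μ K d k j Dw (2 * m) / klLevUnitF β M 0 m (d * k - 1)))) ^ N /
            (1 - Φ * towerV D τ (fun m => W * Z ^ m * (klTowerMeasWtPowAt L M β U μ K d k j Dw (2 * m) / klLevUnitF β M 0 m (d * k - 1)))))
    -- the kit's numerics (the law's own)
    (hx₁ : 4 * σ * lam * Q' < 1) (hx₂ : 2 * lam * τ * Q' ≤ 1) (hx₃ : exp 1 * τ * lam * Q' < 1)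
    (hy : Φ * (τ * (ι₁ * lam + ι₂ / (2 * Q') + ι₃ / (4 * Q' ^ 2) + A' * Q' / 4)) < 1)
    (hθ : Φ * (exp 1 * τ * (ι₁ * lam) + (exp 1 * τ) ^ 2 * (ι₂ * lam) + (exp 1 * τ) ^ 3 * (ι₃ * lam ^ 2) +
      A' * (exp 1 * τ * Q') * ((exp 1 * τ * lam * Q') ^ 3 / (1 - exp 1 * τ * lam * Q'))) < 1) :
    klWtPinnedSumPow L M β μ K J' j Dw 2
        ((klEffectiveAction L M β U μ K klE0 J₂ - klTowerInput L M β U μ K d k) -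
          grassmannLaplacian ℂ (hubbardCovSliceCT L M β μ 0 K (klScale klE0 J₂) (klScale klE0 (d * k))) (klTowerInput L M β U μ K d k)) i w'' ≤
      (15 * σ ^ 2 * (ι₃ * lam ^ 2) + A' * (4 * Q') * ((4 * σ * lam * Q') ^ 3 / (1 - 4 * σ * lam * Q')) +
          exp 1 * ψ * (τ * (ι₁ * lam + ι₂ / (2 * Q') + ι₃ / (4 * Q' ^ 2) + A' * Q' / 4)) *
            (Φ * (τ * (ι₁ * lam + ι₂ / (2 * Q') + ι₃ / (4 * Q' ^ 2) + A' * Q' / 4)) /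
              (1 - Φ * (τ * (ι₁ * lam + ι₂ / (2 * Q') + ι₃ / (4 * Q' ^ 2) + A' * Q' / 4))))) *
        klLevUnitF β M 0 1 (d * k) := by
  have hU0 : 0 < klLevUnitF β M 0 1 (d * k) := klLevUnitF_pos hβ 0 _ _
  rw [← div_le_iff₀ hU0]
  exact towerStepTwoSub_le_closed (D := D)
    (μ := fun m => W * Z ^ m * (klTowerMeasWtPowAt L M β U μ K d k j Dw (2 * m) / klLevUnitF β M 0 m (d * k - 1)))
    hσ hΦ hψ hτ hA'0 hlam hQ'0 hμ0 hι₁ hι₂ hι₃ hprof hx₁ hx₂ hx₃ hy hθ hstep₂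

end Export

end Summit.HubbardSuperconductivity.HubbardSuperconductivity.Theorems.EngineV8

end
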